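import Literature.Claims.NS.Alneel2026
import Literature.Analysis.FluidPDE.VorticityCalculus
import Literature.Analysis.FluidPDE.VectorCalculusProofs
import Mathlib.Analysis.Calculus.BumpFunction.InnerProduct
import Mathlib.MeasureTheory.Measure.Haar.NormedSpace
import HarnessLib

/-!
# C156 `Alneel2026` — SECOND refuter's witness against Theorem 2.1: the data `w_N` (fields file)

`Literature.Claims.NS.Alneel2026.Thm21 C` (Theorem 2.1 p. 2 l. 2–6, the «Universal Scale Law»
`R(t)² X(t) ≤ 16 C E₀` with the charitable half-energy radius `R_inf` of Def 1.2) is false for EVERY real `C`,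
already on the initial slice (`Thm21_field C`, p. 2 display (5)/(8) read on data via the skeleton's own bridge
`thm21_field_of_thm21` = the tree's local existence): the single-scale, divergence-free, compactly supported data
`w_N = curl(φ · N⁻¹(cos N x₂, sin N x₂, 0))` (`φ` a fixed bump, `= 1` on `B₁`, supported in `B₂`) satisfy, uniformly
in `N ≥ 1`, `‖w_N‖_∞ ≤ M := 1 + ‖curl‖·sup‖∇φ‖`, hence `E₀(w_N) ≤ M²|B̄₂|/2` and — since a ball of radius
`r < r₀ := 1/(2(M²+1))` carries energy `≤ M² r³ |B₁| < |B₁|/4 ≤ E₀/2` — `R_inf(w_N) ≥ r₀`; while on `B₁`,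
`w_N = −(cos N x₂, sin N x₂, 0)` so `X(w_N) ≥ N²|B₁|`. The scale law then reads `r₀² N² |B₁| ≤ 16|C|·M²|B̄₂|/2`
for every `N` — absurd. No centre (`IsCentre`) has to be exhibited: `R_inf` is bounded below directly.
Consequences: `¬ Thm21 C` (along solutions), `¬ Thm21_ex`, and `¬ (Step2_localisation ∧ Step6_display C ∧ Step5_L21)`
through the printed derivation `thm21_of_steps`. Scratch of ns-claims-refuter-2 g7 (second refuter; records-grade
ADDENDUM material for the filer under conv. (b)); it does not move the keyed token `Step6_display` (VERDICT
refuter-8 g4 12:35:26Z, CONCUR 12:37:37Z).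

WHAT THIS IS NOT: not a claim about NS regularity or blow-up; not a claim about any author beyond the
typed locator.
-/

set_option linter.dupNamespace false

noncomputable section

open Real Set Function MeasureTheory Metric
open scoped ENNReal NNReal ContDiff Topology

namespace Summit.NavierStokesRegularity.NavierStokesRegularity.Theorems.Alneel2026Second

open Literature.Analysis Literature.Analysis.FluidPDE
open Literature.Claims.NS.Alneel2026
open Literature.Claims.NS.Chae2007 (IsDatum)

/-- basis vector `e_k`. [folklore] -/
def e (k : Fin 3) : E3 := EuclideanSpace.single k (1 : ℝ)

/-- coordinate functional `x ↦ x₂`. [folklore] -/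
def π2 : E3 →L[ℝ] ℝ := EuclideanSpace.proj (2 : Fin 3)

/-- kit lemma (plumbing). [folklore] -/
@[simp] theorem π2_apply (x : E3) : π2 x = x 2 := rfl

/-- kit lemma (plumbing). [folklore] -/
@[simp] theorem e_apply (k i : Fin 3) : (e k) i = if i = k then 1 else 0 := by
  simp [e]

/-- `‖a e₀ + b e₁‖² = a² + b²`. [folklore] -/
theorem norm_sq_lin (a b : ℝ) : ‖a • e 0 + b • e 1‖ ^ 2 = a ^ 2 + b ^ 2 := by
  rw [EuclideanSpace.norm_eq, Real.sq_sqrt (Finset.sum_nonneg fun _ _ => sq_nonneg _)]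
  simp [Fin.sum_univ_three, e_apply]

/-- the oscillating potential `Gs_N(x) = N⁻¹ (cos(N x₂), sin(N x₂), 0)`. [folklore] -/
def Gs (N : ℝ) (x : E3) : E3 := (N⁻¹ * Real.cos (N * x 2)) • e 0 + (N⁻¹ * Real.sin (N * x 2)) • e 1

/-- the profile `Ws_N(x) = (−cos(N x₂), −sin(N x₂), 0) = curl Gs_N`. [folklore] -/
def Ws (N : ℝ) (x : E3) : E3 := (-Real.cos (N * x 2)) • e 0 + (-Real.sin (N * x 2)) • e 1

/-- rank-one map `v ↦ (v₂) a`. [folklore] -/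
def P (a : E3) : E3 →L[ℝ] E3 := π2.smulRight a

/-- kit lemma (plumbing). [folklore] -/
@[simp] theorem P_apply (a v : E3) : P a v = (v 2) • a := by simp [P]

/-- kit lemma (plumbing). [folklore] -/
theorem hasFDerivAt_x2 (x : E3) : HasFDerivAt (fun y : E3 => y 2) π2 x := π2.hasFDerivAt

/-- kit lemma (plumbing). [folklore] -/
theorem hasFDerivAt_cosN (N : ℝ) (x : E3) :
    HasFDerivAt (fun y : E3 => Real.cos (N * y 2)) ((-(Real.sin (N * x 2))) • (N • π2)) x := by
  have h : HasFDerivAt (fun y : E3 => N * y 2) (N • π2) x := (hasFDerivAt_x2 x).const_mul N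
  exact (Real.hasDerivAt_cos (N * x 2)).comp_hasFDerivAt x h

/-- kit lemma (plumbing). [folklore] -/
theorem hasFDerivAt_sinN (N : ℝ) (x : E3) :
    HasFDerivAt (fun y : E3 => Real.sin (N * y 2)) ((Real.cos (N * x 2)) • (N • π2)) x := by
  have h : HasFDerivAt (fun y : E3 => N * y 2) (N • π2) x := (hasFDerivAt_x2 x).const_mul N
  exact (Real.hasDerivAt_sin (N * x 2)).comp_hasFDerivAt x h

/-- `D Gs_N(x) = −sin(N x₂) P(e₀) + cos(N x₂) P(e₁)` (`N ≠ 0`). [folklore] -/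
theorem hasFDerivAt_Gs {N : ℝ} (hN : N ≠ 0) (x : E3) :
    HasFDerivAt (Gs N) ((-Real.sin (N * x 2)) • P (e 0) + (Real.cos (N * x 2)) • P (e 1)) x := by
  have h0 := (((hasFDerivAt_cosN N x).const_mul N⁻¹).smul_const (e 0))
  have h1 := (((hasFDerivAt_sinN N x).const_mul N⁻¹).smul_const (e 1))
  have := h0.add h1
  refine this.congr_fderiv ?_
  ext v i
  simp [P, smul_smul]
  field_simp

/-- `D Ws_N(x) = N sin(N x₂) P(e₀) − N cos(N x₂) P(e₁)`. [folklore] -/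
theorem hasFDerivAt_Ws (N : ℝ) (x : E3) :
    HasFDerivAt (Ws N) ((N * Real.sin (N * x 2)) • P (e 0) + (-(N * Real.cos (N * x 2))) • P (e 1)) x := by
  have h0 := ((hasFDerivAt_cosN N x).neg.smul_const (e 0))
  have h1 := ((hasFDerivAt_sinN N x).neg.smul_const (e 1))
  have := h0.add h1
  refine this.congr_fderiv ?_
  ext v i
  simp [P, smul_smul]
  ring

/-- `curl Gs_N = Ws_N` (`N ≠ 0`). [folklore] -/
theorem curl_Gs {N : ℝ} (hN : N ≠ 0) (x : E3) : curl (Gs N) x = Ws N x := by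
  unfold curl
  rw [(hasFDerivAt_Gs hN x).fderiv]
  ext i
  fin_cases i <;> simp [Ws]

/-- `‖Ws_N(x)‖ = 1`. [folklore] -/
theorem norm_Ws (N : ℝ) (x : E3) : ‖Ws N x‖ = 1 := by
  have h : ‖Ws N x‖ ^ 2 = 1 := by
    rw [Ws, norm_sq_lin]; nlinarith [Real.cos_sq_add_sin_sq (N * x 2)]
  have h0 : 0 ≤ ‖Ws N x‖ := norm_nonneg _
  nlinarith [h, h0, sq_nonneg (‖Ws N x‖ - 1)]

/-- `‖Gs_N(x)‖ = |N|⁻¹`. [folklore] -/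
theorem norm_Gs (N : ℝ) (x : E3) : ‖Gs N x‖ = |N|⁻¹ := by
  have h : ‖Gs N x‖ ^ 2 = (|N|⁻¹) ^ 2 := by
    rw [Gs, norm_sq_lin, inv_pow, sq_abs]
    have := Real.cos_sq_add_sin_sq (N * x 2)
    rw [mul_pow, mul_pow, ← mul_add, this, mul_one, inv_pow]
  have h0 : 0 ≤ ‖Gs N x‖ := norm_nonneg _
  have h1 : 0 ≤ |N|⁻¹ := by positivity
  nlinarith [h, h0, h1, sq_nonneg (‖Gs N x‖ - |N|⁻¹)]

/-- `|D Ws_N(x)|²_F ≥ N²` (the `e₂`-column has norm `|N|`). [folklore] -/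
theorem frob_Ws_ge (N : ℝ) (x : E3) : N ^ 2 ≤ frobeniusNormSq (fderiv ℝ (Ws N) x) := by
  rw [(hasFDerivAt_Ws N x).fderiv, frobeniusNormSq_eq_sum (EuclideanSpace.basisFun (Fin 3) ℝ)]
  have hcol : ‖((N * Real.sin (N * x 2)) • P (e 0) + (-(N * Real.cos (N * x 2))) • P (e 1))
      (EuclideanSpace.basisFun (Fin 3) ℝ 2)‖ ^ 2 = N ^ 2 := by
    have : ((N * Real.sin (N * x 2)) • P (e 0) + (-(N * Real.cos (N * x 2))) • P (e 1))
        (EuclideanSpace.basisFun (Fin 3) ℝ 2) = (N * Real.sin (N * x 2)) • e 0 + (-(N * Real.cos (N * x 2))) • e 1 := by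
      ext i; simp [P]
    rw [this, norm_sq_lin]; nlinarith [Real.sin_sq_add_cos_sq (N * x 2)]
  rw [← hcol]
  exact Finset.single_le_sum (f := fun i => ‖((N * Real.sin (N * x 2)) • P (e 0) +
    (-(N * Real.cos (N * x 2))) • P (e 1)) (EuclideanSpace.basisFun (Fin 3) ℝ i)‖ ^ 2)
    (fun i _ => sq_nonneg _) (Finset.mem_univ 2)

/-! ### The datum `w_N = curl (φ • Gs_N)` -/

/-- the cutoff: a smooth bump, `= 1` on `closedBall 0 1`, supported in `ball 0 2`. [folklore] -/
def bump : ContDiffBump (0 : E3) := ⟨1, 2, one_pos, one_lt_two⟩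

/-- the cutoff as a function. [folklore] -/
def φ (x : E3) : ℝ := bump x

/-- kit lemma (plumbing). [folklore] -/
theorem φ_contDiff : ContDiff ℝ ∞ φ := bump.contDiff
/-- kit lemma (plumbing). [folklore] -/
theorem φ_hasCompactSupport : HasCompactSupport φ := bump.hasCompactSupport
/-- kit lemma (plumbing). [folklore] -/
theorem φ_eq_one {x : E3} (hx : x ∈ ball (0 : E3) 1) : φ x = 1 :=
  bump.one_of_mem_closedBall (ball_subset_closedBall hx)
/-- kit lemma (plumbing). [folklore] -/
theorem tsupport_φ : tsupport φ = closedBall (0 : E3) 2 := bump.tsupport_eq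
/-- kit lemma (plumbing). [folklore] -/
theorem φ_abs_le_one (x : E3) : |φ x| ≤ 1 := by
  rw [φ, abs_of_nonneg bump.nonneg]; exact bump.le_one

/-- the potential `G_N = φ • Gs_N`. [folklore] -/
def G (N : ℝ) (x : E3) : E3 := φ x • Gs N x

/-- **the datum** `w_N = curl G_N` (smooth, compactly supported, divergence free). [folklore] -/
def w (N : ℝ) : E3 → E3 := curl (G N)

/-- kit lemma (plumbing). [folklore] -/
theorem contDiff_Gs (N : ℝ) : ContDiff ℝ ∞ (Gs N) := by
  have h2 : ContDiff ℝ ∞ (fun x : E3 => x 2) := π2.contDiff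
  have hc : ContDiff ℝ ∞ (fun x : E3 => Real.cos (N * x 2)) := Real.contDiff_cos.comp (contDiff_const.mul h2)
  have hs : ContDiff ℝ ∞ (fun x : E3 => Real.sin (N * x 2)) := Real.contDiff_sin.comp (contDiff_const.mul h2)
  exact ((contDiff_const.mul hc).smul contDiff_const).add ((contDiff_const.mul hs).smul contDiff_const)

/-- kit lemma (plumbing). [folklore] -/
theorem contDiff_Ws (N : ℝ) : ContDiff ℝ ∞ (Ws N) := by
  have h2 : ContDiff ℝ ∞ (fun x : E3 => x 2) := π2.contDiff
  have hc : ContDiff ℝ ∞ (fun x : E3 => Real.cos (N * x 2)) := Real.contDiff_cos.comp (contDiff_const.mul h2)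
  have hs : ContDiff ℝ ∞ (fun x : E3 => Real.sin (N * x 2)) := Real.contDiff_sin.comp (contDiff_const.mul h2)
  exact (hc.neg.smul contDiff_const).add (hs.neg.smul contDiff_const)

/-- kit lemma (plumbing). [folklore] -/
theorem contDiff_G (N : ℝ) : ContDiff ℝ ∞ (G N) := φ_contDiff.smul (contDiff_Gs N)

/-- kit lemma (plumbing). [folklore] -/
theorem tsupport_G_subset (N : ℝ) : tsupport (G N) ⊆ closedBall (0 : E3) 2 :=
  (tsupport_smul_subset_left φ (Gs N)).trans tsupport_φ.le

/-- kit lemma (plumbing). [folklore] -/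
theorem hasCompactSupport_G (N : ℝ) : HasCompactSupport (G N) :=
  HasCompactSupport.of_support_subset_isCompact (isCompact_closedBall (0 : E3) 2)
    ((subset_tsupport _).trans (tsupport_G_subset N))

/-- kit lemma (plumbing). [folklore] -/
theorem contDiff_w (N : ℝ) : ContDiff ℝ ∞ (w N) :=
  contDiff_curl ((contDiff_G N).of_le (by exact_mod_cast le_top))

/-- kit lemma (plumbing). [folklore] -/
theorem hasCompactSupport_w (N : ℝ) : HasCompactSupport (w N) := hasCompactSupport_curl (hasCompactSupport_G N)

/-- kit lemma (plumbing). [folklore] -/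
theorem tsupport_w_subset (N : ℝ) : tsupport (w N) ⊆ closedBall (0 : E3) 2 := by
  refine closure_minimal (fun x hx => ?_) isClosed_closedBall
  by_contra h
  exact hx (curl_eq_zero_of_notMem_tsupport fun h' => h (tsupport_G_subset N h'))

/-- kit lemma (plumbing). [folklore] -/
theorem isDivFree_w (N : ℝ) : VectorCalculus.IsDivFree (w N) := fun x =>
  divergence_curl_eq_zero_holds (G N) ((contDiff_G N).of_le (WithTop.coe_le_coe.mpr le_top)) x

/-- kit lemma (plumbing). [folklore] -/
theorem isDatum_w (N : ℝ) : IsDatum (w N) :=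
  isDatum_of_hasCompactSupport (contDiff_w N) (isDivFree_w N) (hasCompactSupport_w N)

/-- On the unit ball `G_N = Gs_N` near every point. [folklore] -/
theorem G_eventuallyEq {N : ℝ} {x : E3} (hx : x ∈ ball (0 : E3) 1) : G N =ᶠ[𝓝 x] Gs N :=
  Filter.eventuallyEq_of_mem (isOpen_ball.mem_nhds hx) fun y hy => by simp [G, φ_eq_one hy]

/-- On the unit ball `w_N = Ws_N`. [folklore] -/
theorem w_eq_Ws {N : ℝ} (hN : N ≠ 0) {x : E3} (hx : x ∈ ball (0 : E3) 1) : w N x = Ws N x := by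
  rw [w, curl_eq_curlCLM, (G_eventuallyEq hx).fderiv_eq, ← curl_eq_curlCLM, curl_Gs hN]

/-- … hence `Dw_N = DWs_N` on the unit ball. [folklore] -/
theorem fderiv_w_eq {N : ℝ} (hN : N ≠ 0) {x : E3} (hx : x ∈ ball (0 : E3) 1) :
    fderiv ℝ (w N) x = fderiv ℝ (Ws N) x :=
  Filter.EventuallyEq.fderiv_eq
    (Filter.eventuallyEq_of_mem (isOpen_ball.mem_nhds hx) fun _ hy => w_eq_Ws hN hy)

/-- `|Dw_N(x)|²_F ≥ N²` on the unit ball. [folklore] -/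
theorem frob_w_ge {N : ℝ} (hN : N ≠ 0) {x : E3} (hx : x ∈ ball (0 : E3) 1) :
    N ^ 2 ≤ frobeniusNormSq (fderiv ℝ (w N) x) := by
  rw [fderiv_w_eq hN hx]; exact frob_Ws_ge N x

/-- A uniform bound for the cutoff gradient. [folklore] -/
theorem exists_bound_fderiv_φ : ∃ K : ℝ, 0 ≤ K ∧ ∀ x, ‖fderiv ℝ φ x‖ ≤ K := by
  obtain ⟨C, hC⟩ := (φ_contDiff.continuous_fderiv (by simp)).bounded_above_of_compact_support
    (φ_hasCompactSupport.fderiv (𝕜 := ℝ))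
  exact ⟨max C 0, le_max_right _ _, fun x => (hC x).trans (le_max_left _ _)⟩

/-- **Uniform pointwise bound** `‖w_N(x)‖ ≤ 1 + ‖curlCLM‖ K` for `N ≥ 1`. [folklore] -/
theorem norm_w_le {K : ℝ} (hK : ∀ x, ‖fderiv ℝ φ x‖ ≤ K) {N : ℝ} (hN : 1 ≤ N) (x : E3) :
    ‖w N x‖ ≤ 1 + ‖curlCLM‖ * K := by
  have hN0 : N ≠ 0 := by positivity
  have hφd : DifferentiableAt ℝ φ x := (φ_contDiff.differentiable (by simp)).differentiableAt
  have hGd : DifferentiableAt ℝ (Gs N) x := ((contDiff_Gs N).differentiable (by simp)).differentiableAt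
  have h := curl_smul hφd hGd
  have hw : w N x = φ x • curl (Gs N) x + curlCLM ((fderiv ℝ φ x).smulRight (Gs N x)) := h
  rw [hw, curl_Gs hN0]
  have h1 : ‖φ x • Ws N x‖ ≤ 1 := by
    rw [norm_smul, norm_Ws, mul_one, Real.norm_eq_abs]; exact φ_abs_le_one x
  have h2 : ‖curlCLM ((fderiv ℝ φ x).smulRight (Gs N x))‖ ≤ ‖curlCLM‖ * K := by
    refine (norm_curlCLM_smulRight_le _ _).trans ?_
    rw [norm_Gs]
    have : |N|⁻¹ ≤ 1 := by
      rw [abs_of_pos (by positivity)]; exact inv_le_one_of_one_le₀ hN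
    have hK0 : 0 ≤ K := (norm_nonneg _).trans (hK x)
    have hKx := hK x
    calc ‖curlCLM‖ * (‖fderiv ℝ φ x‖ * |N|⁻¹) ≤ ‖curlCLM‖ * (K * 1) := by gcongr
      _ = ‖curlCLM‖ * K := by ring
  exact (norm_add_le _ _).trans (add_le_add h1 h2)

end Summit.NavierStokesRegularity.NavierStokesRegularity.Theorems.Alneel2026Second

end
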